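import Summits.ABC.IUTFork.Charitable.Thm311D3DeriveIff
import Summits.ABC.IUTFork.Charitable.Thm311D1D2Concordance
import HarnessLib

/-!
# Branch D — CONCORDANCE, team D3's side (post-lift): D1 Part (iii) ⟺ D2 Part (iii) ⟺ D3's whole maximal reading ⟺ `PilotKummerCompat`

Proof-only file (D-0012; NO definition, NO `Prop` fact) of the abc-iut cell, BLOCK D (rung LADDER-ABC:A2.D), written by abc-iut-D3-prv
(gen 2) AFTER abc-iut-D-ref-2's «D (batch 2): BLIND LIFTED for TEAM D3» (STATUS 2026-08-26T09:16:57Z); team split agreed with the anchor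
abc-iut-D3-typ g3 09:53:11Z: THIS file = the D3↔D1 and D3↔D2 legs + the joint statement; the D3↔D4 leg is abc-iut-D3-typ's
`Thm311D3D4Concordance.lean`; prose cross-walk = plan/D3/CONCORDANCE-D3.md. TAKES NO SIDE on [IUTchIII] Cor. 3.12 or on any author or
team; proposes NO grade. Every D1/D2 declaration is consumed BY NAME (typings p428378/p429129 `Thm311D1`, p428473 `Thm311D2`; derivations
`Thm311D1Derive`, `Thm311D2Derive`; the D1↔D2 concordance p429595 `Thm311D1D2Concordance`); D3 side = typing p431029 + X-elimination p434033
(`D3DeriveIff.thm311Charitable_3_iff : Thm311Charitable_3 ⟺ PartI ∧ PartII ∧ PilotKummerCompatHull ∧ PilotKummerCompat`).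

WHAT IS PROVED (kernel; comparison AT THE LOAD-BEARING LEVEL modulo the frozen typing of (i) ∧ (ii), as the anchors agreed — the three
teams' own (i)/(ii) paraphrases differ inessentially and are not compared conjunct-by-conjunct):
§1 D2's two non-load-bearing Part (iii) conjuncts are THEOREMS of frozen (i) (`unitPortionLink_of_multiradialCompat`,
   `numberFieldLink_of_multiradialCompat`: the line-`n` data IS one ⟨(Ind1)∪(Ind2)⟩-transport of the line-`(n−1)` data, abc-iut-L6-t13
   `MRData.mem_RLGP_iff`), so **`partIII_2_iff_pilotKummerCompat`: D2's ENTIRE Part (iii) ⟺ `PilotKummerCompat`** modulo MR + (ii)(b); and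
   **`partIII_1_iff_pilotKummerCompat`: D1's ENTIRE Part (iii) ⟺ `PilotKummerCompat`** modulo MR + (ii)(b) + the two region pins (D1's hull
   rung L1 follows from the square under the pins).
§2 **THE JOINT STATEMENT `concordance_D1_D2_D3`**: under frozen (i) ∧ (ii) and Cor. 3.12's two region pins,
   `D1.PartIII S P qK ⟺ D2.PartIII S P.n qK ⟺ Thm311Charitable_3 S P ρ qK ⟺ PilotKummerCompat S P qK`
   — three blind typings put their whole (iii)-content (D3: its whole reading, strips and all) on ONE datum-level sentence, abc-iut-w5-d068's
   p420303. Over the typed Theorem 3.11 (`FullSituation.Statement`) the same holds with no further hypothesis (`concordance_of_statement`).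
§3 Cross-implications at the typing level: D3's maximal reading YIELDS D1's load-bearing clause at every line and D1's whole Part (iii)
   under the pins, D2's square at every line and D2's whole Part (iii) outright (`linkKummer_of_charitable_3`, `partIII_1_of_charitable_3`,
   `kummerLinkSquare_of_charitable_3`, `partIII_2_of_charitable_3`); conversely D1's / D2's official typings yield D3's maximal reading
   given frozen (i) ∧ (ii) and the Θ-pin (`charitable_3_of_charitable_1`, `charitable_3_of_charitable_2`).
§4 Hull rung: under the three pins and frozen (i) ∧ (ii), D3's delimiter-respecting `Thm311Charitable_3H` ⟺ D1's L1 `PartIII.hull` ⟺ the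
   cell's `PilotKummerCompatHull` (= D2's Reading Y conjunct) (`hullRung_concordance`).
READING (neutral, for §L): the block-D kernel answer is team-independent — each maximal charitable typing closes G exactly through
`PilotKummerCompat` ([IUTchIII] Thm. 3.11 (iii)(c) final clause p. 158 l. 5–15 / Rmk. 3.11.1 (iii) (IPL) p. 160 l. 30–45 read as a
datum-level identification), and nothing else in any of the three typings bears on `qK`. S. Mochizuki, *Inter-universal Teichmüller
theory III*, kurims manuscript (May 2020) [claim: Mochizuki2012, status: disputed]; [cite: ScholzeStix2018, §2.2 pp. 9–10]. Typed ≠ proved;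
derived-under-a-reading ≠ endorsed; no side taken.
-/

noncomputable section

open Set

namespace Summit.ABC.IUTFork.Charitable.D3Concordance

open Thm311 Cor312 Cor312Vol Literature.IUT.LogThetaLattice

section General

variable {T : ThetaIndex} (S : LatticeSituation T) (P : Cor312.Setting S.toSituation)
  (ρ : (∀ v : T.V, v ∈ T.Vbad → Set (S.L.StarPacket v)) → ∀ (j : T.Label) (vQ : T.VQ), Set (S.L.Packet j vQ))
  (qK : ∀ v : T.V, v ∈ T.Vbad → Set (S.L.StarPacket v))

/-! ## 1. D2's and D1's whole Part (iii) reduce to `PilotKummerCompat` -/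

/-- **D2's (iii)(a)(b) clause `III_ab_UnitPortionLink` is a THEOREM of frozen (i)**: by `MultiradialCompat` the line-`n` data is ONE
⟨(Ind1)∪(Ind2)⟩-transport of the line-`(n−1)` data (`MRData.mem_RLGP_iff`), which transports the log-shells `shellPk`. [claim: Mochizuki2012, status: disputed] -/
theorem unitPortionLink_of_multiradialCompat (hMR : S.MultiradialCompat) : D2.III_ab_UnitPortionLink S := fun n => by
  obtain ⟨Φ, hΦ, hmap⟩ := (MRData.mem_RLGP_iff (S.D (n - 1)) (S.D n)).1 (S.mem_RLGP_of_multiradialCompat hMR (n - 1) n)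
  exact ⟨Φ, hΦ, fun j vQ => by rw [hmap]; rfl⟩

/-- **D2's (iii)(d) clause `III_d_NumberFieldLink` is a THEOREM of frozen (i)** (same transport, on the number fields `Mmod`).
[claim: Mochizuki2012, status: disputed] -/
theorem numberFieldLink_of_multiradialCompat (hMR : S.MultiradialCompat) : D2.III_d_NumberFieldLink S := fun n => by
  obtain ⟨Φ, hΦ, hmap⟩ := (MRData.mem_RLGP_iff (S.D (n - 1)) (S.D n)).1 (S.mem_RLGP_of_multiradialCompat hMR (n - 1) n)
  exact ⟨Φ, hΦ, fun j => by rw [hmap]; rfl⟩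

/-- **D2's ENTIRE Part (iii) at the Corollary's line ⟺ `PilotKummerCompat`**, modulo frozen (i) `MultiradialCompat` and (ii)(b) at every
column: its four conjuncts are two theorems of (i) (above), the carrier tautology `III_c_Stabilized` (abc-iut-D2-typ
`III_c_Stabilized_holds`) and the load-bearing square (abc-iut-D2-prv `square_iff_pilotKummerCompat`). [claim: Mochizuki2012, status: disputed] -/
theorem partIII_2_iff_pilotKummerCompat (hMR : S.MultiradialCompat) (hKumB : ∀ n : ℤ, (S.col n).KummerB (S.D n)) :
    D2.PartIII S P.n qK ↔ PilotKummerCompat S P qK := by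
  have hsq := D2.square_iff_pilotKummerCompat S P qK (D2.perm_of_multiradialCompat S hMR) (fun n m v hv => hKumB n m v hv)
  exact ⟨fun h => hsq.1 h.2.2.1, fun h => ⟨unitPortionLink_of_multiradialCompat S hMR, D2.III_c_Stabilized_holds S, hsq.2 h,
    numberFieldLink_of_multiradialCompat S hMR⟩⟩

/-- **D1's ENTIRE Part (iii) ⟺ `PilotKummerCompat`**, modulo frozen (i), (ii)(b) and the two region pins: its conjuncts are the load-bearing
L2 `linkKummer` (p429595 `linkKummer_iff_pilotKummerCompat`), the hull rung L1 (which the square gives under the pins: datum ⟹ region ⟹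
hull, abc-iut-w5-d068) and the carrier-level (d) (abc-iut-D1-typ `numberFieldLink_holds`). [claim: Mochizuki2012, status: disputed] -/
theorem partIII_1_iff_pilotKummerCompat (hMR : S.MultiradialCompat) (hKumB : ∀ n : ℤ, (S.col n).KummerB (S.D n))
    (hpin : PinnedRegions S P ρ qK) : D1.PartIII S P qK ↔ PilotKummerCompat S P qK := by
  have hL := linkKummer_iff_pilotKummerCompat S P qK ((D1.perm_iff_multiradialCompat S).2 hMR) (fun n m v hv => hKumB n m v hv)
  refine ⟨fun h => hL.1 h.1, fun h => ⟨hL.2 h, fun _ j vQ => ?_, D1.numberFieldLink_holds S⟩⟩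
  rw [hpin.2 j vQ]
  exact pilotKummerCompatHull_of_region S P ρ qK hpin.1 (pilotKummerCompatRegion_of_pilotKummerCompat S P ρ qK hpin.1.1 h) j vQ

/-! ## 2. The joint statement -/

/-- **CONCORDANCE D1 / D2 / D3 (kernel).** Under the frozen typing of Thm. 3.11 (i) ∧ (ii) and Cor. 3.12's two region pins, team D1's Part
(iii), team D2's Part (iii) at the Corollary's line, and team D3's ENTIRE maximal reading `Thm311Charitable_3` are each equivalent to
abc-iut-w5-d068's `PilotKummerCompat` — hence to one another. (D3: p434033 `thm311Charitable_3_iff_of_thetaPinned`; the D3↔D4 leg is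
abc-iut-D3-typ's companion file.) [claim: Mochizuki2012, status: disputed] -/
theorem concordance_D1_D2_D3 (hI : S.PartI) (hII : S.PartII) (hpin : PinnedRegions S P ρ qK) :
    (D1.PartIII S P qK ↔ PilotKummerCompat S P qK) ∧
      (D2.PartIII S P.n qK ↔ PilotKummerCompat S P qK) ∧
      (Summit.ABC.IUTFork.Charitable.Thm311Charitable_3 S P ρ qK ↔ PilotKummerCompat S P qK) :=
  have hKumB : ∀ n : ℤ, (S.col n).KummerB (S.D n) := fun n => (hII n).2.1
  ⟨partIII_1_iff_pilotKummerCompat S P ρ qK hI.2.2 hKumB hpin, partIII_2_iff_pilotKummerCompat S P qK hI.2.2 hKumB,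
    (D3DeriveIff.thm311Charitable_3_iff_of_thetaPinned S P ρ qK hpin.1).trans
      ⟨fun h => h.2.2, fun h => ⟨hI, hII, h⟩⟩⟩

/-- The pairwise forms, read off the joint statement. [claim: Mochizuki2012, status: disputed] -/
theorem charitable_3_iff_partIII_1 (hI : S.PartI) (hII : S.PartII) (hpin : PinnedRegions S P ρ qK) :
    Summit.ABC.IUTFork.Charitable.Thm311Charitable_3 S P ρ qK ↔ D1.PartIII S P qK :=
  have h := concordance_D1_D2_D3 S P ρ qK hI hII hpin
  h.2.2.trans h.1.symm

/-- The pairwise forms, read off the joint statement. [claim: Mochizuki2012, status: disputed] -/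
theorem charitable_3_iff_partIII_2 (hI : S.PartI) (hII : S.PartII) (hpin : PinnedRegions S P ρ qK) :
    Summit.ABC.IUTFork.Charitable.Thm311Charitable_3 S P ρ qK ↔ D2.PartIII S P.n qK :=
  have h := concordance_D1_D2_D3 S P ρ qK hI hII hpin
  h.2.2.trans h.2.1.symm

/-- **Without the pins, with the hull clause explicit**: frozen (i) ∧ (ii) ⊢ `Thm311Charitable_3 ⟺ PilotKummerCompatHull ∧ D1's L2` and
`⟺ PilotKummerCompatHull ∧ D2's square` (D3's only asymmetry is the hull conjunct `IPLHull` inside its maximal conjunction).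
[claim: Mochizuki2012, status: disputed] -/
theorem charitable_3_iff_hull_and_loadBearing (hI : S.PartI) (hII : S.PartII) :
    (Summit.ABC.IUTFork.Charitable.Thm311Charitable_3 S P ρ qK ↔ PilotKummerCompatHull S P ρ qK ∧ D1.PartIII.linkKummer S qK P.n) ∧
      (Summit.ABC.IUTFork.Charitable.Thm311Charitable_3 S P ρ qK ↔
        PilotKummerCompatHull S P ρ qK ∧ D2.III_c_KummerLinkSquare S P.n qK) := by
  have hKumB : ∀ n : ℤ, (S.col n).KummerB (S.D n) := fun n => (hII n).2.1
  have hL := linkKummer_iff_pilotKummerCompat S P qK ((D1.perm_iff_multiradialCompat S).2 hI.2.2) (fun n m v hv => hKumB n m v hv)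
  have hsq := D2.square_iff_pilotKummerCompat S P qK (D2.perm_of_multiradialCompat S hI.2.2) (fun n m v hv => hKumB n m v hv)
  rw [D3DeriveIff.thm311Charitable_3_iff S P ρ qK, hL, hsq]
  exact ⟨⟨fun h => h.2.2, fun h => ⟨hI, hII, h⟩⟩, ⟨fun h => h.2.2, fun h => ⟨hI, hII, h⟩⟩⟩

/-! ## 3. Cross-implications at the typing level -/

/-- D3's maximal reading yields D1's load-bearing clause L2 at EVERY line index (no pin, nothing frozen assumed: D3's conjunction carries
its own (i)/(ii)). [claim: Mochizuki2012, status: disputed] -/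
theorem linkKummer_of_charitable_3 (h : Summit.ABC.IUTFork.Charitable.Thm311Charitable_3 S P ρ qK) (n : ℤ) :
    D1.PartIII.linkKummer S qK n := by
  obtain ⟨hI, hII, -, hK⟩ := (D3DeriveIff.thm311Charitable_3_iff S P ρ qK).1 h
  have hperm : D1.PartI.perm S := (D1.perm_iff_multiradialCompat S).2 hI.2.2
  have hL := (linkKummer_iff_pilotKummerCompat S P qK hperm (fun n m v hv => (hII n).2.1 m v hv)).2 hK
  rw [D1.linkKummer_iff_of_perm S qK hperm n P.n]
  exact (D1.linkKummer_iff_of_perm S qK hperm P.n P.n).1 hL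

/-- D3's maximal reading yields D2's load-bearing square at EVERY line index. [claim: Mochizuki2012, status: disputed] -/
theorem kummerLinkSquare_of_charitable_3 (h : Summit.ABC.IUTFork.Charitable.Thm311Charitable_3 S P ρ qK) (n' : ℤ) :
    D2.III_c_KummerLinkSquare S n' qK := by
  obtain ⟨hI, hII, -, -⟩ := (D3DeriveIff.thm311Charitable_3_iff S P ρ qK).1 h
  exact (linkKummer_iff_kummerLinkSquare S qK ((D1.perm_iff_multiradialCompat S).2 hI.2.2) (fun n m v hv => (hII n).2.1 m v hv)
    P.n n').1 (linkKummer_of_charitable_3 S P ρ qK h P.n)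

/-- D3's maximal reading yields D2's ENTIRE Part (iii) at the Corollary's line, outright. [claim: Mochizuki2012, status: disputed] -/
theorem partIII_2_of_charitable_3 (h : Summit.ABC.IUTFork.Charitable.Thm311Charitable_3 S P ρ qK) : D2.PartIII S P.n qK := by
  obtain ⟨hI, hII, -, hK⟩ := (D3DeriveIff.thm311Charitable_3_iff S P ρ qK).1 h
  exact (partIII_2_iff_pilotKummerCompat S P qK hI.2.2 (fun n => (hII n).2.1)).2 hK

/-- D3's maximal reading yields D1's ENTIRE Part (iii) under the two region pins. [claim: Mochizuki2012, status: disputed] -/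
theorem partIII_1_of_charitable_3 (h : Summit.ABC.IUTFork.Charitable.Thm311Charitable_3 S P ρ qK) (hpin : PinnedRegions S P ρ qK) :
    D1.PartIII S P qK := by
  obtain ⟨hI, hII, -, hK⟩ := (D3DeriveIff.thm311Charitable_3_iff S P ρ qK).1 h
  exact (partIII_1_iff_pilotKummerCompat S P ρ qK hI.2.2 (fun n => (hII n).2.1) hpin).2 hK

/-- **Team D1's official typing yields team D3's maximal reading**, given the frozen (i) ∧ (ii) (D3's conjunction carries them verbatim)
and the Θ-pin (which makes D3's hull conjunct automatic). [claim: Mochizuki2012, status: disputed] -/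
theorem charitable_3_of_charitable_1 (h1 : D1.Thm311Charitable_1 S P qK) (hI : S.PartI) (hII : S.PartII) (hΘ : ThetaPinned S P ρ) :
    Summit.ABC.IUTFork.Charitable.Thm311Charitable_3 S P ρ qK :=
  (D3DeriveIff.thm311Charitable_3_iff_of_thetaPinned S P ρ qK hΘ).2
    ⟨hI, hII, (both_factor_through_pilotKummerCompat S P ρ qK).1 h1⟩

/-- **Team D2's official typing yields team D3's maximal reading**, same side conditions. [claim: Mochizuki2012, status: disputed] -/
theorem charitable_3_of_charitable_2 (h2 : D2.Thm311Charitable_2 S P.n qK) (hI : S.PartI) (hII : S.PartII) (hΘ : ThetaPinned S P ρ) :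
    Summit.ABC.IUTFork.Charitable.Thm311Charitable_3 S P ρ qK :=
  (D3DeriveIff.thm311Charitable_3_iff_of_thetaPinned S P ρ qK hΘ).2
    ⟨hI, hII, (both_factor_through_pilotKummerCompat S P ρ qK).2.1 h2⟩

/-! ## 4. The hull rung -/

/-- **HULL RUNGS CONCORDANT**: under the three pins and frozen (i) ∧ (ii), team D3's delimiter-respecting `Thm311Charitable_3H` ⟺ team D1's
L1 `PartIII.hull` ⟺ the cell's `PilotKummerCompatHull` (= team D2's Reading Y conjunct of `Thm311Charitable_2H`) — p434033
`thm311Charitable_3H_iff` with p429595 `hull_iff_pilotKummerCompatHull`. [claim: Mochizuki2012, status: disputed] -/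
theorem hullRung_concordance (hI : S.PartI) (hII : S.PartII) (hpin : PinnedRegions3 S P ρ qK) :
    (Summit.ABC.IUTFork.Charitable.Thm311Charitable_3H S P ρ qK ↔ D1.PartIII.hull S P) ∧
      (Summit.ABC.IUTFork.Charitable.Thm311Charitable_3H S P ρ qK ↔ PilotKummerCompatHull S P ρ qK) :=
  have h3 : Summit.ABC.IUTFork.Charitable.Thm311Charitable_3H S P ρ qK ↔ PilotKummerCompatHull S P ρ qK :=
    (D3DeriveIff.thm311Charitable_3H_iff S P ρ qK).trans ⟨fun h => h.2.2, fun h => ⟨hI, hII, h⟩⟩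
  ⟨h3.trans (hull_iff_pilotKummerCompatHull S P ρ qK hpin).symm, h3⟩

/-- D2's hull-level `Thm311Charitable_2H` gives D3's `Thm311Charitable_3H` given frozen (i) ∧ (ii) (its Reading Y conjunct IS the hull clause).
[claim: Mochizuki2012, status: disputed] -/
theorem charitable_3H_of_charitable_2H (h : D2.Thm311Charitable_2H S P ρ qK) (hI : S.PartI) (hII : S.PartII) :
    Summit.ABC.IUTFork.Charitable.Thm311Charitable_3H S P ρ qK :=
  (D3DeriveIff.thm311Charitable_3H_iff S P ρ qK).2 ⟨hI, hII, h.2.2.2⟩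

end General

/-! ## 5. Over the typed Theorem 3.11 -/

section Typed

variable {T : ThetaIndex} (F : FullSituation T) (P : Cor312.Setting F.toLatticeSituation.toSituation)
  (ρ : (∀ v : T.V, v ∈ T.Vbad → Set (F.L.StarPacket v)) → ∀ (j : T.Label) (vQ : T.VQ), Set (F.L.Packet j vQ))
  (qK : ∀ v : T.V, v ∈ T.Vbad → Set (F.L.StarPacket v))

/-- **CONCORDANCE OVER THE TYPED THEOREM 3.11**: given `FullSituation.Statement` and the two region pins, D1's Part (iii), D2's Part (iii)
and D3's maximal reading are each ⟺ `PilotKummerCompat`. [claim: Mochizuki2012, status: disputed] -/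
theorem concordance_of_statement (hThm : F.Statement) (hpin : PinnedRegions F.toLatticeSituation P ρ qK) :
    (D1.PartIII F.toLatticeSituation P qK ↔ PilotKummerCompat F.toLatticeSituation P qK) ∧
      (D2.PartIII F.toLatticeSituation P.n qK ↔ PilotKummerCompat F.toLatticeSituation P qK) ∧
      (Summit.ABC.IUTFork.Charitable.Thm311Charitable_3 F.toLatticeSituation P ρ qK ↔
        PilotKummerCompat F.toLatticeSituation P qK) :=
  concordance_D1_D2_D3 F.toLatticeSituation P ρ qK hThm.1 hThm.2.1 hpin

end Typed

end Summit.ABC.IUTFork.Charitable.D3Concordance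

end
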